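import Literature.NumberTheory.EllipticCurves.Castella2018.ErratumHidaMembersCongruence
import HarnessLib

/-!
# Castella's erratum, proof of Thm. 1.1 (p. 4) — the Hida MEMBER PACKAGE in TORSION-FREE, PREMISE form
# (design rider R-f = ARM-P R-37): (a)+(b) members, (2.5)_m `Ch_{Λ_𝒪}(X^Σ_ac(A_{g_m}))Λ_𝒪^ur ⊂ (L^Σ_p(g_m))`
# [via Fouquet–Wan Thm. 4.41, UNREFEREED] asked ONLY under the torsion premise the consumer uses, and (c)
# `(L^Σ_p(g_m), p^m) = (L^Σ_p(f), p^m)` — the Road-FF OPEN hypothesis WITHOUT erratum Thm. 2.3's torsion clause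

Cell `bsd-stepL` (run/shared/lean/pub/bsd-stepL/), seat `bsd-stepL-imc-p1` g11 (the consumer's prover seat), executing
the design rider R-f of bsd-cited-r17's D-AUDIT ADDENDUM-7 on the sibling file `ErratumHidaMembersCongruence.lean`
(its `erratum_members_exists_isTorsion_charIdeal_le_congruence_OPEN`, "O14" below; cell INBOX 2026-08-27T07:34:51Z +
P.S. 07:39:02Z; director-bsd ROUTING 07:51:22Z "R-f … LOW, first toucher"). SIBLING FILE, not an append: O14's file is
276 lines and the tree caps files at 400; O14 is untouched and stays the statement of record until its consumers re-point.

## Why (verbatim from the audit, checked against the tree)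

In O14 the members' TORSION conjunct "`X^Σ_ac(A_{g_m})` is `Λ_{𝒪_m}`-torsion" is print's sentence ([Castella2018Erratum]
Thm. 2.3: "`X^Σ_ac(A_g)` is `Λ_𝒪`-torsion, and `Ch_{Λ_𝒪}(X^Σ_ac(A_g))Λ_𝒪^ur = (L^Σ_p(g))`"), but its PRINT PROVENANCE is
the erratum's Heegner-side paragraph — (2.3) "`Ch_{Λ_𝒪}(X_ac(A_g))Λ_𝒪^ur ⊃ (L_p(g))`" from [LV19, Thm. 4.7],
[CH18, Thm. 6.1 / 5.7], [CGS23, Thm. 5.5.1] "as in [BCK21, Thm. 5.2]" — applied to members of weight `k_m > 2`,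
`k_m ≡ 2 (mod p − 1)`, i.e. `k_m ≥ p + 1`, which is OUTSIDE [CH18] Hypothesis (H)(a) "`p ∤ 2(2r−1)!Nφ(N)`" (`k = 2r`) and
[LV19]'s admissibility "`p ∤ 6N(k−2)!φ(N)c_f`" (ARM-P GAP-β). The Road-FF consumer never uses it: the feeder
`Summit.BirchSwinnertonDyer.Rank1Residual.X11b.P2.RoadFF.fittingCongruenceFrameTwoSlotAt_of_members_descent_le_printed`
takes member torsion only as the PREMISE of its binder `hCh : ∀ m, 1 ≤ m → Module.IsTorsion (R' m) (Nm m) →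
(Module.charIdeal (R' m) (Nm m)).map (φ' m) ≤ Ideal.span {Lm m}` (the non-torsion case is vacuous at the Fitting
level: `CongruenceDescent.map_fittingIdeal_le_of_printed_charIdeal_le`), and in the deciding-stub proof
`P2.RoadFF.fittingCongruenceFrameAtErratumDataB_of_facts` (`Theorems/ErratumRoadFiveIMCDivRoadFFFittingFrameBOfFacts.lean`)
the torsion conjunct is bound to a dead `have hT`. So the conjunct is SURPLUS PROVENANCE: it alone imports GAP-β into
the ONE OPEN by-name input `stub_roadFF_memberPackage` of crux `stmt-BirchSwinnertonDyer-20169` (`IMCDivAtErratumDataAllR`).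

## Content

* ONE named `Prop`, `erratum_members_exists_charIdeal_le_of_isTorsion_congruence_OPEN` = O14 with the torsion conjunct
  REMOVED and (2.5)_m guarded by that torsion as a HYPOTHESIS ("`X^Σ_ac(A_{g_m})` torsion → `Ch·S₀⟦T⟧ ⊆ (L_m)`");
  every binder and every other clause (frame of `f` [Cas18 Thm. 3.1], members [Ski16], receptacles, (c) [Cas20
  Thm. 2.11] as printed, `=`) is O14's byte for byte. All of O14's flags apply (`Mem-r3`, `Mem-receptacle`,
  `Mem-one-sided`, `Mem-M-ge-3`, `Mem-orient`, `Mem-own-ring`, `Mem-per-m`, `Mem-A-side`, `Mem-frame-existential`,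
  `Mem-top`; see that file's module docstring) plus `Mem-torsion-premise` (print's Thm. 2.3 asserts torsion AND the
  equality; here NEITHER the torsion NOR the `⊃` half is transcribed, and the `⊂` half is asked only under torsion).
* PROVED: `…OPEN.of_OPEN : O14 → this` (projection — the new `Prop` is WEAKER than O14, so re-targeting the Road-FF stub
  loses nothing and every consumer of this file is also served by O14), and the consumer-shape API
  `exists_frame_members_charIdeal_le_of_isTorsion_congruence_le_of_OPEN` ((c) weakened to `≤`, torsion premise kept).
* A by-citation discharge of THIS `Prop` needs (a)(b) [Ski16 §2.6/§3.1] + (2.4) ⟹ (2.5) [FW21 Thm. 4.41 with Cor. 7.21,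
  Lemma 7.22; JSW17 Cor. 3.4.2] + (c) [Cas20 Thm. 2.11] — NOT erratum Thm. 2.3 in full (no (2.3), no torsion).
HONEST FRAMING: an UNREFEREED step (erratum (2.4) ⟹ (2.5) rests on [FouquetWan2021, Thm. 4.41], a preprint) enters the
tree ONLY as an explicitly labelled OPEN hypothesis (`def … _OPEN : Prop`, `[claim: …]`), never as a theorem; every
result using it is CONDITIONAL; nothing about any curve is asserted. ONE new named `Prop` (D-0014: +1 unproved,
claim-tagged, implied by the existing O14 — net content 0; O14 becomes retirable once its two Summits consumers re-point)
and small PROVED API; no `sorry`, no definition besides the `Prop`, no instance. STATUS: **PRE** (as O14).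

Source, verbatim, and transcription: module docstring of `ErratumHidaMembersCongruence.lean` ([Castella2018Erratum] §2,
Thm. 2.3, (2.3)–(2.5), proof of Thm. 1.1 (a)(b)(c), footnote 1; pp. 2–4 of held text `paper:url-e83251f1873d`).

References: [Castella2018Erratum] Thm. 2.3, (2.3)–(2.5), proof of Thm. 1.1 (pp. 3–4); [FouquetWan2021] arXiv:2107.13726
Thm. 4.41, Cor. 7.21, Lemma 7.22 (PREPRINT); [Castella2020JIMJ] Thm. 2.11; [Skinner2016PacificMC] §2.6 (2-6-1), §3.1
(a)(b) (p. 191); [Castella2018] Def. 2.2, Thm. 3.1, (3.1) (p. 9); [JetchevSkinnerWan2017] Cor. 3.4.2;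
[CastellaHsieh2018] Hyp. (H)(a); [LongoVigni2019] admissibility (the GAP-β locus; provenance only, not used).
-/

noncomputable section

open scoped Classical

open PowerSeries WeierstrassCurve NumberField IsDedekindDomain Field
  Literature.NumberTheory.EllipticCurves Literature.NumberTheory.EllipticCurves.ModularForms
  Literature.NumberTheory.EllipticCurves.Rank1Residual Literature.NumberTheory.EllipticCurves.BigGaloisRep
  Literature.NumberTheory.EllipticCurves.GreenbergSelmer Literature.NumberTheory.GaloisRepresentations

namespace Literature.NumberTheory.EllipticCurves.Castella2018

section WeakFact

/-- **OPEN HYPOTHESIS — the MEMBER PACKAGE of Castella's erratum, proof of Thm. 1.1 (p. 4), TORSION-FREE PREMISE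
FORM (R-f): (a)+(b) Hida members with their Galois congruence [Ski16 §2.6/§3.1], for each member the ONE-SIDED
divisibility (2.5)_m `Ch_{Λ_𝒪}(X^Σ_ac(A_{g_m}))Λ_𝒪^ur ⊂ (L^Σ_p(g_m))` [via FW21 Thm. 4.41, UNREFEREED] ASKED ONLY
WHEN `X^Σ_ac(A_{g_m})` IS `Λ_{𝒪_m}`-TORSION (premise, as the consumer takes it), and (c)
`(L^Σ_p(g_m), p^m) = (L^Σ_p(f), p^m)` [Cas20 Thm. 2.11]; FRAME-FREE (option (r3)), frame of `f` at `(ι, 𝔭)`, Selmer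
slot at `𝔭bar`.** This is the sibling file's `erratum_members_exists_isTorsion_charIdeal_le_congruence_OPEN` (O14) with the members'
torsion conjunct (erratum Thm. 2.3, Heegner side — ARM-P GAP-β provenance at weight `k_m ≥ p + 1`) REMOVED and (2.5)_m
guarded by that torsion as a hypothesis; all binders and every other clause are O14's byte for byte (flags `Mem-r3`,
`Mem-receptacle`, `Mem-one-sided`, `Mem-M-ge-3`, `Mem-orient`, `Mem-own-ring`, `Mem-per-m`, `Mem-A-side`,
`Mem-frame-existential`, `Mem-top` of O14's module docstring apply unchanged; new flag `Mem-torsion-premise`: print's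
Thm. 2.3 asserts torsion AND equality, here neither torsion nor the `⊃` half is transcribed). WEAKER than O14
(`erratum_members_exists_charIdeal_le_of_isTorsion_congruence_OPEN.of_OPEN`); it SUPERSEDES O14 as the Road-FF OPEN
input (crux `stmt-BirchSwinnertonDyer-20169`). NEVER cite this `Prop` as a theorem: take it as an explicit hypothesis; a
result using it is conditional on unrefereed claims (the erratum; arXiv:2107.13726 Thm. 4.41 via erratum (2.4)).
[claim: Castella2018Erratum, status: under-review]
[claim: FouquetWan2021, status: under-review]
[cite: Castella2020JIMJ, Thm. 2.11 and Def. 2.10 ((c): "(c) follows from [Cas20, Thm. 2.11]")]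
[cite: Skinner2016PacificMC, §2.6 (2-6-1) and §3.1 (a)(b) (p. 191) ((a)(b))]
[cite: Castella2018, Def. 2.2, Thm. 3.1 and (3.1) (p. 9) (the objects `X^Σ_ac`, `L_p(f)`, `L^Σ_p`; shape only, nothing asserted)] -/
def erratum_members_exists_charIdeal_le_of_isTorsion_congruence_OPEN : Prop :=
  ∀ {p : ℕ} [Fact p.Prime] (ι : PadicAlgCl p ≃+* ℂ) (W : WeierstrassCurve ℚ) [W.IsElliptic]
    [W.IsGloballyMinimal] (K : Type) [Field K] [NumberField K]
    (𝔭 𝔭bar : HeightOneSpectrum (𝓞 K)) (κ : ZpExtension K p) (γ : absoluteGaloisGroup K)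
    [Fact (κ.IsTopGenerator γ)] {N : ℕ} [NeZero N] {f : CuspForm (CongruenceSubgroup.Gamma0 N) 2}
    (_ : IsNewformOf W f),
    W.conductorNorm ℤ = N → 3 < p → Mult W p →
    3 ≤ N / p →
    IsImaginaryQuadratic K → (∃ β : ℤ, (4 * N : ℤ) ∣ β ^ 2 - NumberField.discr K) →
    ((Ideal.span {(p : ℤ)}).primesOver (𝓞 K)).ncard = 2 →
    ((p : ℕ) : 𝓞 K) ∈ 𝔭.asIdeal →
    (∀ (w : InfinitePlace K) (k : 𝓞 K), k ∈ 𝔭.asIdeal ↔ ‖ι.symm (w.embedding (k : K))‖ < 1) →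
    ((p : ℕ) : 𝓞 K) ∈ 𝔭bar.asIdeal → 𝔭bar ≠ 𝔭 →
    Irr W p →
    (((Ideal.span {(2 : ℤ)}).primesOver (𝓞 K)).ncard ≠ 2 → Mult W 2) →
    (∀ (q : ℕ) [Fact q.Prime], Mult W q → ((Ideal.span {(q : ℤ)}).primesOver (𝓞 K)).ncard ≠ 2 →
      ¬ W.HasSplitMultiplicativeReductionAtPrime q) →
    (∃ (q : ℕ) (_ : Fact q.Prime), Mult W q ∧ ((Ideal.span {(q : ℤ)}).primesOver (𝓞 K)).ncard ≠ 2 ∧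
      ¬ p ∣ padicValInt q W.minimalDiscriminantInt) →
    (∀ P : (W.baseChange ℚ_[p]).toAffine.Point, p • P = 0 → P = 0) →
    κ.IsAnticyclotomic →
    -- a frame of `f` at `(ι, 𝔭)` [Cas18 Thm. 3.1] (flag `Mem-frame-existential`) …
    ∃ (ΩK : ℂ) (Ωp : (unrIntegers p)ˣ) (L : UnrSeries p),
      ΩK ≠ 0 ∧ IsBDPLFunction ι 𝔭 κ γ f ΩK ((Ωp : unrIntegers p) : ℂ_[p]) L ∧
      -- … and for every `m ≥ 1` a member (a)+(b) …
      ∀ m : ℕ, 1 ≤ m →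
        ∃ D : Skinner2016.HidaCongruentMember W p m,
          ∀ [TopologicalSpace (PowerSeries (padicCoeffIntegers D.ι))]
            [ContinuousSMul (PowerSeries (padicCoeffIntegers D.ι))
              (BigRepModule (padicCoeffIntegers D.ι) p (Cofree D.Δ.ρ (padicCoeffField D.ι)))],
          -- … such that in every receptacle `S₀` of `Λ_{𝒪_m}^ur = Λ_{R₀} ⊗_{ℤ_p} 𝒪_m` (flag `Mem-receptacle`):
          ∀ (S₀ : Type) [CommRing S₀] (a : unrIntegers p →+* S₀) (b : padicCoeffIntegers D.ι →+* S₀)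
            (j : ℤ_[p] →+* unrIntegers p),
            (∀ x : ℤ_[p], ((j x : unrIntegers p) : ℂ_[p]) = algebraMap ℚ_[p] ℂ_[p] (x : ℚ_[p])) →
            a.comp j = b.comp (algebraMap ℤ_[p] (padicCoeffIntegers D.ι)) →
            ∃ Lm : PowerSeries S₀,
              -- (2.5)_m, PREMISE form (flag `Mem-torsion-premise`): IF `X^Σ_ac(A_{g_m})` is `Λ_{𝒪_m}`-torsion
              -- THEN `Ch_{Λ_{𝒪_m}}(X^Σ_ac(A_{g_m}))·S₀⟦T⟧ ⊆ (L^Σ_p(g_m))` [FW21 4.41 — UNREFEREED]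
              (Module.IsTorsion (PowerSeries (padicCoeffIntegers D.ι))
                  (XBig κ (D.Δ.cofreeRepOver K) 𝔭bar (↑(W.sigmaPlacesFinset p K))) →
                (XBig.charIdeal κ (D.Δ.cofreeRepOver K) 𝔭bar (↑(W.sigmaPlacesFinset p K))).map
                    (PowerSeries.map b) ≤ Ideal.span {Lm}) ∧
              -- (c): `(L^Σ_p(g_m), p^m) = (L^Σ_p(f), p^m)`, `L^Σ_p(f) = L_p(f)·P_Σ` [Cas20 2.11, Cas18 (3.1)]
              Ideal.span {Lm} ⊔ Ideal.span {((p : ℕ) : PowerSeries S₀) ^ m} =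
                Ideal.span {PowerSeries.map a (L * PowerSeries.map j (W.sigmaEulerElement p K κ))} ⊔
                  Ideal.span {((p : ℕ) : PowerSeries S₀) ^ m}

set_option maxHeartbeats 800000 in -- two ~40-binder dependent telescopes are unified (as the sibling file's API)
/-- **O14 ⟹ this file's `Prop` (projection): the torsion-free premise form is WEAKER than the OPEN fact O14** —
drop the torsion conjunct and discard the torsion premise of (2.5)_m. In particular every consumer of this file is
also served by O14, and re-targeting the Road-FF stub from O14 to this `Prop` loses nothing. [claim: Castella2018Erratum, status: under-review] -/
theorem erratum_members_exists_charIdeal_le_of_isTorsion_congruence_OPEN.of_OPEN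
    (h : erratum_members_exists_isTorsion_charIdeal_le_congruence_OPEN) :
    erratum_members_exists_charIdeal_le_of_isTorsion_congruence_OPEN := by
  intro _ _ ι W _ _ K _ _ 𝔭 𝔭bar κ γ _ _ _ _ hf hN hp hmult hM hK hHeeg hsplit h𝔭 hcompat h𝔭bar hne hirr h2
    hns hram htors hκ
  obtain ⟨ΩK, Ωp, L, hΩ, hL, hmem⟩ := h ι W K 𝔭 𝔭bar κ γ hf hN hp hmult hM hK hHeeg hsplit h𝔭 hcompat h𝔭bar
    hne hirr h2 hns hram htors hκ
  refine ⟨ΩK, Ωp, L, hΩ, hL, fun m hm => ?_⟩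
  obtain ⟨D, hD⟩ := hmem m hm
  refine ⟨D, fun S₀ _ a b j hj hab => ?_⟩
  obtain ⟨Lm, hCh, hc⟩ := hD.2 S₀ a b j hj hab
  exact ⟨Lm, fun _ => hCh, hc⟩

variable {p : ℕ} [Fact p.Prime] (ι : PadicAlgCl p ≃+* ℂ) (W : WeierstrassCurve ℚ) [W.IsElliptic]
  [W.IsGloballyMinimal] (K : Type) [Field K] [NumberField K] (𝔭 𝔭bar : HeightOneSpectrum (𝓞 K))
  (κ : ZpExtension K p) (γ : absoluteGaloisGroup K) [Fact (κ.IsTopGenerator γ)] {N : ℕ} [NeZero N]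
  {f : CuspForm (CongruenceSubgroup.Gamma0 N) 2} (hf : IsNewformOf W f)
  (hN : W.conductorNorm ℤ = N) (hp : 3 < p) (hmult : Mult W p) (hM : 3 ≤ N / p) (hK : IsImaginaryQuadratic K)
  (hHeeg : ∃ β : ℤ, (4 * N : ℤ) ∣ β ^ 2 - NumberField.discr K)
  (hsplit : ((Ideal.span {(p : ℤ)}).primesOver (𝓞 K)).ncard = 2)
  (h𝔭 : ((p : ℕ) : 𝓞 K) ∈ 𝔭.asIdeal)
  (hcompat : ∀ (w : InfinitePlace K) (k : 𝓞 K),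
    k ∈ 𝔭.asIdeal ↔ ‖ι.symm (w.embedding (k : K))‖ < 1)
  (h𝔭bar : ((p : ℕ) : 𝓞 K) ∈ 𝔭bar.asIdeal) (hne : 𝔭bar ≠ 𝔭)
  (hirr : Irr W p) (h2 : ((Ideal.span {(2 : ℤ)}).primesOver (𝓞 K)).ncard ≠ 2 → Mult W 2)
  (hns : ∀ (q : ℕ) [Fact q.Prime], Mult W q →
    ((Ideal.span {(q : ℤ)}).primesOver (𝓞 K)).ncard ≠ 2 → ¬ W.HasSplitMultiplicativeReductionAtPrime q)
  (hram : ∃ (q : ℕ) (_ : Fact q.Prime), Mult W q ∧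
    ((Ideal.span {(q : ℤ)}).primesOver (𝓞 K)).ncard ≠ 2 ∧ ¬ p ∣ padicValInt q W.minimalDiscriminantInt)
  (htors : ∀ P : (W.baseChange ℚ_[p]).toAffine.Point, p • P = 0 → P = 0)
  (hκ : κ.IsAnticyclotomic)

include hf hN hp hmult hM hK hHeeg hsplit h𝔭 hcompat h𝔭bar hne hirr h2 hns hram htors hκ

set_option maxHeartbeats 800000 in
/-- **The consumer's shape from the torsion-free premise form: a frame of `f` at `(ι, 𝔭)` and, for every `m ≥ 1`,
a member with, in every receptacle, SOME `L_m` such that `N_m` torsion → `Ch(N_m)·S₀⟦T⟧ ⊆ (L_m)` and the ONE-SIDED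
congruence `(L_m) ⊆ (L·j(P_Σ)) + (p^m)`** (binders `hCh` — premise form verbatim — and `hc` of
`P2.RoadFF.fittingCongruenceFrameTwoSlotAt_of_members_descent_le_printed`, with `(c)` weakened from `=` to `≤` by
`le_sup_left`). CONDITIONAL on this file's OPEN fact; nothing asserted.
[claim: Castella2018Erratum, status: under-review] [claim: FouquetWan2021, status: under-review] -/
theorem exists_frame_members_charIdeal_le_of_isTorsion_congruence_le_of_OPEN
    (h : erratum_members_exists_charIdeal_le_of_isTorsion_congruence_OPEN) :
    ∃ (ΩK : ℂ) (Ωp : (unrIntegers p)ˣ) (L : UnrSeries p),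
      ΩK ≠ 0 ∧ IsBDPLFunction ι 𝔭 κ γ f ΩK ((Ωp : unrIntegers p) : ℂ_[p]) L ∧
      ∀ m : ℕ, 1 ≤ m →
        ∃ D : Skinner2016.HidaCongruentMember W p m,
          ∀ [TopologicalSpace (PowerSeries (padicCoeffIntegers D.ι))]
            [ContinuousSMul (PowerSeries (padicCoeffIntegers D.ι))
              (BigRepModule (padicCoeffIntegers D.ι) p (Cofree D.Δ.ρ (padicCoeffField D.ι)))],
          ∀ (S₀ : Type) [CommRing S₀] (a : unrIntegers p →+* S₀) (b : padicCoeffIntegers D.ι →+* S₀)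
            (j : ℤ_[p] →+* unrIntegers p),
            (∀ x : ℤ_[p], ((j x : unrIntegers p) : ℂ_[p]) = algebraMap ℚ_[p] ℂ_[p] (x : ℚ_[p])) →
            a.comp j = b.comp (algebraMap ℤ_[p] (padicCoeffIntegers D.ι)) →
            ∃ Lm : PowerSeries S₀,
              (Module.IsTorsion (PowerSeries (padicCoeffIntegers D.ι))
                  (XBig κ (D.Δ.cofreeRepOver K) 𝔭bar (↑(W.sigmaPlacesFinset p K))) →
                (XBig.charIdeal κ (D.Δ.cofreeRepOver K) 𝔭bar (↑(W.sigmaPlacesFinset p K))).map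
                    (PowerSeries.map b) ≤ Ideal.span {Lm}) ∧
              Ideal.span {Lm} ≤
                Ideal.span {PowerSeries.map a (L * PowerSeries.map j (W.sigmaEulerElement p K κ))} ⊔
                  Ideal.span {((p : ℕ) : PowerSeries S₀) ^ m} := by
  have h' := h ι W K 𝔭 𝔭bar κ γ hf hN hp hmult hM hK hHeeg hsplit h𝔭 hcompat h𝔭bar hne hirr h2 hns hram
    htors hκ
  obtain ⟨ΩK, Ωp, L, hΩ, hL, hmem⟩ := h'
  refine ⟨ΩK, Ωp, L, hΩ, hL, fun m hm => ?_⟩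
  obtain ⟨D, hD⟩ := hmem m hm
  refine ⟨D, fun S₀ _ a b j hj hab => ?_⟩
  obtain ⟨Lm, hCh, hc⟩ := hD S₀ a b j hj hab
  exact ⟨Lm, hCh, le_sup_left.trans hc.le⟩

end WeakFact

end Literature.NumberTheory.EllipticCurves.Castella2018

end
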